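import Summits.NavierStokesRegularity.NavierStokesRegularity.Theses.LerayQuarterDissipation
import Summits.NavierStokesRegularity.NavierStokesRegularity.Theorems.TypeIDSSLiouvilleConjecture
import Summits.NavierStokesRegularity.NavierStokesRegularity.Theorems.ChiralWindowDoorClassDerivDecay
import Summits.NavierStokesRegularity.NavierStokesRegularity.Theorems.DssFarFieldSlavingBlowupTypeIDssProfileSmoothRepresentativeAe
import Summits.NavierStokesRegularity.NavierStokesRegularity.Theorems.FiniteDissipationLiouville.Negative.DSSLeafIsLiouville
import Literature.Analysis.FluidPDE.KochTataruKernel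
import Literature.Analysis.FluidPDE.VorticityDoubleConeSelfSimilar
import Literature.Analysis.FluidPDE.ScalingUniformRecurrence
import Literature.Analysis.FluidPDE.HyperbolicDSSOrbit
import HarnessLib

/-!
# Cruxes `FiniteDissipationLiouville` (stmt-NavierStokesRegularity-22144) and
# `RecurrentDissipativeLiouville` (stmt-NavierStokesRegularity-22508): hardness certificate —
# the Type-I ENVELOPE class lies inside the finite-dissipation stratum, so both cruxes imply the
# catalogued open conjecture `TypeIDSSLiouvilleConjecture` / Bradshaw–Tsai's Open Problem 5.1

Theorems file of route `LerayQuarterDissipation` (seat ns-lqd-p1 g2; lands `--supports` the two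
cruxes). Navier–Stokes regularity is NOT proved by anything here; no summit is.

The route's thesis singles out the stratum
`𝒟 = {Type-I ancient mild fields ū in the KNSS gauge with ∫_ℝ³ ‖∇ū(s)‖² ≤ K/√(−s) for all s < 0}`
and asks for Liouville/apex-regularity only on `𝒟` (`FiniteDissipationLiouville`, FDL) or on its
uniformly scaling-recurrent members (`RecurrentDissipativeLiouville`, RDL). The lead's line `birth`
proved the DSS leaf of FDL FROM the catalogued wall `∀ c > 1, TypeIDSSLiouville c`
(`…Birth.stub_dssExclusion_of_typeIDSSLiouville`, p583968). This file proves the CONVERSE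
direction, so that the DSS content of both cruxes is EXACTLY that wall:

* `lintegral_fderiv_sq_le_of_gradDecay` — the analytic core: a scale-invariant gradient bound
  `(‖x‖ + √(−t))² ‖∇V(t,x)‖ ≤ K` gives Leray's quarter-rate dissipation law
  `∫ ‖∇V(s)‖² ≤ K² I₂ /√(−s)`, `I₂ = ∫_ℝ³ (1 + ‖w‖²)^{-2} dw` (since `(‖x‖+√(−s))⁴ ≥ (−s + ‖x‖²)²`
  and `∫ (σ + ‖x‖²)^{-2} dx = I₂ σ^{-1/2}`, tree `lintegral_add_norm_sq_rpow_neg`);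
* `exists_dissipationLaw_of_hasTypeIDecay` — **the Type-I envelope class lies in `𝒟`**: a Type-I
  ancient mild field in the KNSS gauge with the space–time envelope `‖V(t,x)‖ ≤ D/(‖x‖ + √(−t))`
  obeys the dissipation law for some `K'` (the tree's scale-invariant derivative decay of such
  fields, `…ChiralWindowDoorClassDerivDecay.apexScaleInvariantBounds`, KNSS 2009 Prop. 4.1 /
  Thm 6.1 as assembled by the RellichScar lane);
* `rotatedTypeIDSSLiouville_of_finiteDissipationLiouville`,
  `typeIDSSLiouville_of_finiteDissipationLiouville`,
  `typeIDSSLiouvilleConjecture_of_finiteDissipationLiouville` — FDL implies the plain AND the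
  rotated Type-I `λ`-DSS Liouville statements for every `λ` and every `R ∈ O(3)` (Bradshaw–Tsai
  2017 Open Problem 5.1; Tsai GSM 192 Conj. 8.8–8.9; canonical `@[conjecture]` leaf
  `Summit.NavierStokesRegularity.NavierStokesRegularity.TypeIDSSLiouvilleConjecture`): pass to the
  smooth Oseen-gauge representative with the same envelope (`rdssClass_smoothRepresentative_ae`,
  KNSS §3–4 in tree), which lies in `𝒟` by the previous bullet; FDL bounds it at the apex; a
  (rotated) DSS field bounded at the apex vanishes on the past
  (`IsRotatedDSS.eq_zero_of_norm_le_parabolicCylinder`, Chae–Wolf 2017 §3 step 1); a.e.-equal slices;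
* `scalingRecurrence_of_isDiscretelySelfSimilar`, `typeIDSSLiouville_of_recurrentDissipativeLiouville`
  — a `λ`-DSS field satisfies the route's sup-norm uniform-recurrence clause with return gap
  `log λ` (exact returns at `n log λ`, `IsDiscretelySelfSimilar.nsScalingFlow_int_mul_log`), hence
  RDL implies `TypeIDSSLiouville λ` for every `λ` as well;
* contrapositives for the disprover / the route's kill criteria:
  `not_finiteDissipationLiouville_of_isTypeIDSSProfile`,
  `not_recurrentDissipativeLiouville_of_isTypeIDSSProfile_refl` — ANY Type-I (rotated) DSS profile
  (`IsTypeIDSSProfile`, the object of Bradshaw–Tsai's open problem and of cell pub-ns-dss) refutes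
  FDL, and any plain one refutes RDL; no extra `∇V ∈ L²` hypothesis is needed (the route text's
  "cheapest falsifier" paragraph, now a theorem).

Consequences for the line's bookkeeping: FDL ⟹ `TypeIDSSLiouvilleConjecture` ⟹ (lead, p583968)
the DSS leaf `stub_dssExclusion`; so the registered wall stub `stub_typeIDSSLiouvilleWall` is not
merely sufficient but NECESSARY for the crux, and the same holds for child 22508 on plain DSS.

References: Koch–Nadirashvili–Seregin–Šverák, Acta Math. 203 (2009) = arXiv:0709.3599, §3–4;
Chae–Wolf, arXiv:1610.09464, §3; Bradshaw–Tsai, Comm. PDE 42 (2017), §5, Open Problem 5.1;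
Tsai, GSM 192 (2018), Conj. 8.8–8.9.
-/

noncomputable section

-- the summit and its single sub-problem share the name (CONVENTIONS §1), as in every Theorems file
set_option linter.dupNamespace false

namespace Summit.NavierStokesRegularity.NavierStokesRegularity.Theorems.FiniteDissipationLiouville.Hardness

open MeasureTheory Set Filter Topology Metric Function
open Literature.Analysis Literature.Analysis.FluidPDE
open scoped ENNReal

/-! ### The analytic core: scale-invariant gradient decay gives the quarter-rate dissipation law -/

/-- **Scale-invariant gradient decay implies Leray's quarter-rate dissipation law.** If
`(‖x‖ + √(−t))² ‖∇V(t,x)‖ ≤ K` for all `t < 0` and `x`, then for every `s < 0`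
`∫ ‖∇V(s,x)‖² dx ≤ K² I₂ / √(−s)` with `I₂ = ∫_ℝ³ (1 + ‖w‖²)^{-2} dw`: pointwise
`‖∇V‖² ≤ K²/(‖x‖ + √(−s))⁴ ≤ K² (−s + ‖x‖²)^{-2}`, and `∫ (σ + ‖x‖²)^{-2} dx = I₂ σ^{-1/2}`
(parabolic scaling, tree `lintegral_add_norm_sq_rpow_neg`). -/
theorem lintegral_fderiv_sq_le_of_gradDecay {K : ℝ}
    {V : ℝ → EuclideanSpace ℝ (Fin 3) → EuclideanSpace ℝ (Fin 3)}
    (hK : ∀ t : ℝ, t < 0 → ∀ x, (‖x‖ + Real.sqrt (-t)) ^ 2 * ‖fderiv ℝ (V t) x‖ ≤ K) :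
    ∀ s : ℝ, s < 0 → ∫⁻ x, ‖fderiv ℝ (V s) x‖ₑ ^ 2 ≤
      ENNReal.ofReal ((K ^ 2 * ∫ w : EuclideanSpace ℝ (Fin 3), (1 + ‖w‖ ^ 2) ^ (-(2 : ℝ))) /
        Real.sqrt (-s)) := by
  intro s hs
  have hσ : 0 < -s := neg_pos.2 hs
  have ha : 0 < Real.sqrt (-s) := Real.sqrt_pos.2 hσ
  set I₂ : ℝ := ∫ w : EuclideanSpace ℝ (Fin 3), (1 + ‖w‖ ^ 2) ^ (-(2 : ℝ)) with hI₂_def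
  -- pointwise majorant by the Koch–Tataru envelope
  have hpt : ∀ x : EuclideanSpace ℝ (Fin 3), ‖fderiv ℝ (V s) x‖ₑ ^ 2 ≤
      ENNReal.ofReal (K ^ 2) * ENNReal.ofReal ((-s + ‖x‖ ^ 2) ^ (-(2 : ℝ))) := by
    intro x
    have hden : 0 < (‖x‖ + Real.sqrt (-s)) ^ 2 := by positivity
    have h1 : ‖fderiv ℝ (V s) x‖ ≤ K / (‖x‖ + Real.sqrt (-s)) ^ 2 := by
      rw [le_div_iff₀ hden, mul_comm]
      exact hK s hs x
    have h2 : ‖fderiv ℝ (V s) x‖ ^ 2 ≤ K ^ 2 / ((‖x‖ + Real.sqrt (-s)) ^ 2) ^ 2 := by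
      rw [← div_pow]
      exact pow_le_pow_left₀ (norm_nonneg _) h1 2
    have hbase : 0 < -s + ‖x‖ ^ 2 := by positivity
    have h3 : K ^ 2 / ((‖x‖ + Real.sqrt (-s)) ^ 2) ^ 2 ≤ K ^ 2 * (-s + ‖x‖ ^ 2) ^ (-(2 : ℝ)) := by
      rw [Real.rpow_neg hbase.le, ← div_eq_mul_inv]
      have hsq : (-s + ‖x‖ ^ 2) ^ (2 : ℝ) = (-s + ‖x‖ ^ 2) ^ (2 : ℕ) := by
        rw [← Real.rpow_natCast]
        norm_num
      rw [hsq]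
      refine div_le_div_of_nonneg_left (sq_nonneg K) (by positivity) ?_
      refine pow_le_pow_left₀ hbase.le ?_ 2
      nlinarith [Real.sq_sqrt hσ.le, norm_nonneg x, Real.sqrt_nonneg (-s)]
    calc ‖fderiv ℝ (V s) x‖ₑ ^ 2 = ENNReal.ofReal (‖fderiv ℝ (V s) x‖ ^ 2) := by
          rw [← ofReal_norm, ENNReal.ofReal_pow (norm_nonneg _)]
      _ ≤ ENNReal.ofReal (K ^ 2 * (-s + ‖x‖ ^ 2) ^ (-(2 : ℝ))) :=
          ENNReal.ofReal_le_ofReal (h2.trans h3)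
      _ = ENNReal.ofReal (K ^ 2) * ENNReal.ofReal ((-s + ‖x‖ ^ 2) ^ (-(2 : ℝ))) :=
          ENNReal.ofReal_mul (sq_nonneg K)
  -- the space integral of the envelope
  have h3 : (Module.finrank ℝ (EuclideanSpace ℝ (Fin 3)) : ℝ) < 2 * 2 := by
    rw [finrank_euclideanSpace_fin]; norm_num
  have hexp : ((Module.finrank ℝ (EuclideanSpace ℝ (Fin 3)) : ℝ) / 2 - 2) = -(1 / 2 : ℝ) := by
    rw [finrank_euclideanSpace_fin]; norm_num
  have hint : ∫⁻ x : EuclideanSpace ℝ (Fin 3), ENNReal.ofReal ((-s + ‖x‖ ^ 2) ^ (-(2 : ℝ))) =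
      ENNReal.ofReal ((-s) ^ (-(1 / 2 : ℝ)) * I₂) := by
    rw [lintegral_add_norm_sq_rpow_neg h3 hσ, hexp]
  have hhalf : (-s) ^ (-(1 / 2 : ℝ)) = (Real.sqrt (-s))⁻¹ := by
    rw [Real.rpow_neg hσ.le, Real.sqrt_eq_rpow]
  calc ∫⁻ x, ‖fderiv ℝ (V s) x‖ₑ ^ 2
      ≤ ∫⁻ x : EuclideanSpace ℝ (Fin 3),
          ENNReal.ofReal (K ^ 2) * ENNReal.ofReal ((-s + ‖x‖ ^ 2) ^ (-(2 : ℝ))) :=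
        lintegral_mono hpt
    _ = ENNReal.ofReal (K ^ 2) *
          ∫⁻ x : EuclideanSpace ℝ (Fin 3), ENNReal.ofReal ((-s + ‖x‖ ^ 2) ^ (-(2 : ℝ))) := by
        rw [lintegral_const_mul' _ _ ENNReal.ofReal_ne_top]
    _ = ENNReal.ofReal (K ^ 2 * ((-s) ^ (-(1 / 2 : ℝ)) * I₂)) := by
        rw [hint, ← ENNReal.ofReal_mul (sq_nonneg K)]
    _ = ENNReal.ofReal ((K ^ 2 * I₂) / Real.sqrt (-s)) := by
        rw [hhalf, div_eq_mul_inv]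
        ring_nf

/-! ### The Type-I envelope class lies in the finite-dissipation stratum -/

/-- **The Type-I envelope class lies in the stratum `𝒟`.** A Type-I ancient mild field `V` in the
KNSS gauge (`IsTypeIAncientMild C V`) with the space–time envelope `‖V(t,x)‖ ≤ D/(‖x‖ + √(−t))`
(`HasTypeIDecay D V`) obeys the quarter-rate dissipation law `∫ ‖∇V(s)‖² ≤ K'/√(−s)` (`s < 0`) for
some `K'`: the field is classical on `(−∞,0)` for a pressure
(`exists_isClassicalNSSolutionOn_Iio_of_isTypeIAncientMild`), the tree's scale-invariant bounds give
`(‖x‖ + √(−t))² ‖∇V‖ ≤ K` (`…ChiralWindowDoorClassDerivDecay.apexScaleInvariantBounds`; KNSS 2009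
Prop. 4.1), and `lintegral_fderiv_sq_le_of_gradDecay` integrates it. -/
theorem exists_dissipationLaw_of_hasTypeIDecay {C D : ℝ}
    {V : ℝ → EuclideanSpace ℝ (Fin 3) → EuclideanSpace ℝ (Fin 3)}
    (hV : IsTypeIAncientMild C V) (hdec : HasTypeIDecay D V) :
    ∃ K' : ℝ, ∀ s : ℝ, s < 0 →
      ∫⁻ x, ‖fderiv ℝ (V s) x‖ₑ ^ 2 ≤ ENNReal.ofReal (K' / Real.sqrt (-s)) := by
  obtain ⟨q, hsol⟩ := exists_isClassicalNSSolutionOn_Iio_of_isTypeIAncientMild hV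
  obtain ⟨q', K, -, hK⟩ := ChiralWindowDoorClassDerivDecay.apexScaleInvariantBounds V q D hsol hdec
  exact ⟨K ^ 2 * ∫ w : EuclideanSpace ℝ (Fin 3), (1 + ‖w‖ ^ 2) ^ (-(2 : ℝ)),
    lintegral_fderiv_sq_le_of_gradDecay fun t ht x => (hK t ht x).1⟩

/-- **"Not singular at the apex" is a bound on a backward parabolic cylinder** (rewriting the
negation of the cruxes' apex clause in the tree's `parabolicCylinder` vocabulary). -/
theorem exists_bound_parabolicCylinder_of_not_singularAtApex
    {V : ℝ → EuclideanSpace ℝ (Fin 3) → EuclideanSpace ℝ (Fin 3)}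
    (hns : ¬ (∀ r > 0, ∀ M : ℝ, ∃ t ∈ Set.Ioo (-(r ^ 2)) (0 : ℝ),
      ∃ x ∈ Metric.ball (0 : EuclideanSpace ℝ (Fin 3)) r, M < ‖V t x‖)) :
    ∃ ρ : ℝ, 0 < ρ ∧ ∃ B : ℝ,
      ∀ z ∈ parabolicCylinder ρ (0 : ℝ × EuclideanSpace ℝ (Fin 3)), ‖V z.1 z.2‖ ≤ B := by
  push Not at hns
  obtain ⟨r, hr, M, hM⟩ := hns
  refine ⟨r, hr, M, fun z hz => ?_⟩
  rw [mem_parabolicCylinder] at hz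
  obtain ⟨⟨h1, h2⟩, h3⟩ := hz
  simp only [Prod.fst_zero, Prod.snd_zero, zero_sub] at h1 h2 h3
  exact hM z.1 ⟨h1, h2⟩ z.2 (Metric.mem_ball.2 h3)

/-! ### FDL implies the Type-I (rotated) DSS Liouville wall -/

/-- **FDL implies the rotated Type-I `λ`-DSS Liouville statement** `RotatedTypeIDSSLiouville λ R`
for every `λ` and every `R ∈ O(3)` (Bradshaw–Tsai 2017, Open Problem 5.1, rotated half). Given an
ancient mild solution `u` with measurable slices, rotated `λ`-DSS, with a Type-I envelope: its smooth
Oseen-gauge representative `V` (same `(λ, R)`, same envelope constant, slices a.e. equal;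
`rdssClass_smoothRepresentative_ae`) lies in `𝒟` (`exists_dissipationLaw_of_hasTypeIDecay`), so FDL
bounds it on a backward cylinder at the origin, and a rotated-DSS field bounded there vanishes on the
past (`IsRotatedDSS.eq_zero_of_norm_le_parabolicCylinder`); hence `u(t) = 0` a.e. for every `t < 0`. -/
theorem rotatedTypeIDSSLiouville_of_finiteDissipationLiouville
    (hFDL : Theses.LerayQuarterDissipation.FiniteDissipationLiouville) (c : ℝ)
    (R : EuclideanSpace ℝ (Fin 3) ≃ₗᵢ[ℝ] EuclideanSpace ℝ (Fin 3)) :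
    RotatedTypeIDSSLiouville c R := by
  intro hc u hu hmeas hdss hdec
  obtain ⟨C₀, hC₀⟩ := hdec
  obtain ⟨V, hV, hdssV, hdecV, hVu, -⟩ := rdssClass_smoothRepresentative_ae hc hu hmeas hdss hC₀
  obtain ⟨K', hD⟩ := exists_dissipationLaw_of_hasTypeIDecay hV hdecV
  obtain ⟨ρ, hρ, B, hB⟩ :=
    exists_bound_parabolicCylinder_of_not_singularAtApex (hFDL C₀ K' V hV hD)
  have hz : ∀ t < 0, ∀ x, V t x = 0 := hdssV.eq_zero_of_norm_le_parabolicCylinder hc hρ hB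
  intro t ht
  filter_upwards [hVu t ht] with x hx
  rw [Pi.zero_apply, ← hx, hz t ht x]

/-- **FDL implies the plain Type-I `λ`-DSS Liouville statement** `TypeIDSSLiouville λ` for every `λ`
(Bradshaw–Tsai 2017, Open Problem 5.1; the registered wall stub `stub_typeIDSSLiouvilleWall` of the
line `birth` is therefore NECESSARY for the crux, not only sufficient). -/
theorem typeIDSSLiouville_of_finiteDissipationLiouville
    (hFDL : Theses.LerayQuarterDissipation.FiniteDissipationLiouville) (c : ℝ) :
    TypeIDSSLiouville c :=
  (rotatedTypeIDSSLiouville_refl_iff c).1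
    (rotatedTypeIDSSLiouville_of_finiteDissipationLiouville hFDL c _)

/-- **Hardness certificate for the crux `FiniteDissipationLiouville`**: it implies the catalogued
open conjecture `TypeIDSSLiouvilleConjecture` (canonical `@[conjecture]` leaf of this sub-problem;
Tsai, Conjectures 8.8–8.9 / Bradshaw–Tsai 2017, Open Problem 5.1, plain and rotated, every `λ`).
So the crux is at least as hard as that conjecture. -/
theorem typeIDSSLiouvilleConjecture_of_finiteDissipationLiouville
    (hFDL : Theses.LerayQuarterDissipation.FiniteDissipationLiouville) :
    _root_.Summit.NavierStokesRegularity.NavierStokesRegularity.TypeIDSSLiouvilleConjecture :=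
  fun c => ⟨typeIDSSLiouville_of_finiteDissipationLiouville hFDL c,
    fun R => rotatedTypeIDSSLiouville_of_finiteDissipationLiouville hFDL c R⟩

/-- Contrapositive, for the disprover: a failure of `TypeIDSSLiouvilleConjecture` refutes the crux
`FiniteDissipationLiouville`. -/
theorem not_finiteDissipationLiouville_of_not_typeIDSSLiouvilleConjecture
    (h : ¬ _root_.Summit.NavierStokesRegularity.NavierStokesRegularity.TypeIDSSLiouvilleConjecture) :
    ¬ Theses.LerayQuarterDissipation.FiniteDissipationLiouville :=
  fun hFDL => h (typeIDSSLiouvilleConjecture_of_finiteDissipationLiouville hFDL)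

/-- **The route's kill criterion, as a theorem**: ANY Type-I (rotated) DSS profile
(`IsTypeIDSSProfile c R u`: ancient mild, measurable slices, rotated `c`-DSS with `1 < c`, Type-I
envelope, not a.e. zero) refutes `FiniteDissipationLiouville` — the envelope already puts its smooth
representative in the finite-dissipation stratum, so no separate hypothesis `∇V ∈ L²` is needed. -/
theorem not_finiteDissipationLiouville_of_isTypeIDSSProfile {c : ℝ}
    {R : EuclideanSpace ℝ (Fin 3) ≃ₗᵢ[ℝ] EuclideanSpace ℝ (Fin 3)}
    {u : ℝ → EuclideanSpace ℝ (Fin 3) → EuclideanSpace ℝ (Fin 3)} (h : IsTypeIDSSProfile c R u) :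
    ¬ Theses.LerayQuarterDissipation.FiniteDissipationLiouville :=
  fun hFDL => h.not_rotatedTypeIDSSLiouville
    (rotatedTypeIDSSLiouville_of_finiteDissipationLiouville hFDL c R)

/-! ### RDL (child stmt-22508) implies the plain Type-I DSS Liouville wall -/

/-- **A `λ`-DSS field is uniformly scaling-recurrent in the route's sup-norm sense**, with return
gap `log λ` and EXACT returns: every window `[a, a + log λ]` contains an integer multiple
`σ = n log λ` of the period, at which `e^σ V(e^{2σ}s, e^σ y) = V(s, y)` identically
(`IsDiscretelySelfSimilar.nsScalingFlow_int_mul_log`), so the recurrence defect is `0 ≤ ε` on every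
slab. -/
theorem scalingRecurrence_of_isDiscretelySelfSimilar {c : ℝ} (hc : 1 < c)
    {V : ℝ → EuclideanSpace ℝ (Fin 3) → EuclideanSpace ℝ (Fin 3)}
    (hV : IsDiscretelySelfSimilar c V) :
    ∀ ε > 0, ∀ R > 1, ∃ L > 0, ∀ a : ℝ, ∃ σ ∈ Set.Icc a (a + L),
      ∀ s ∈ Set.Icc (-(R ^ 2)) (-(R⁻¹) ^ 2),
      ∀ y ∈ Metric.closedBall (0 : EuclideanSpace ℝ (Fin 3)) R,
        ‖Real.exp σ • V (Real.exp (2 * σ) * s) (Real.exp σ • y) - V s y‖ ≤ ε := by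
  intro ε hε R _
  have hc0 : 0 < c := one_pos.trans hc
  have hℓ : 0 < Real.log c := Real.log_pos hc
  refine ⟨Real.log c, hℓ, fun a => ?_⟩
  set n : ℤ := ⌈a / Real.log c⌉ with hn
  refine ⟨n * Real.log c, ⟨?_, ?_⟩, fun s _ y _ => ?_⟩
  · have h1 : a / Real.log c ≤ n := Int.le_ceil _
    rwa [div_le_iff₀ hℓ] at h1
  · have h1 : (n : ℝ) < a / Real.log c + 1 := Int.ceil_lt_add_one _
    have h2 : (n : ℝ) * Real.log c < (a / Real.log c + 1) * Real.log c :=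
      mul_lt_mul_of_pos_right h1 hℓ
    rw [add_mul, div_mul_cancel₀ _ hℓ.ne', one_mul] at h2
    exact h2.le
  · have h2 := hV.nsScalingFlow_int_mul_log hc0 n
    rw [nsScalingFlow_apply] at h2
    have h3 := congrFun (congrFun h2 s) y
    rw [nsRescale_apply] at h3
    have h4 : Real.exp (2 * (n * Real.log c)) = Real.exp (n * Real.log c) ^ 2 := by
      rw [sq, ← Real.exp_add, two_mul]
    rw [h4, h3, sub_self, norm_zero]
    exact hε.le

/-- **RDL implies the plain Type-I `λ`-DSS Liouville statement** `TypeIDSSLiouville λ` for every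
`λ` (Bradshaw–Tsai 2017, Open Problem 5.1): as for FDL, through the smooth representative (same
`λ`, same envelope; `rdssClass_smoothRepresentative_ae` with `R = 1`), which lies in `𝒟`
(`exists_dissipationLaw_of_hasTypeIDecay`) and is uniformly scaling-recurrent
(`scalingRecurrence_of_isDiscretelySelfSimilar`); RDL bounds it at the apex and the DSS zoom law
kills it (`…Negative.eq_zero_of_dss_of_not_singularAtApex`, cdisprove p-landed). -/
theorem typeIDSSLiouville_of_recurrentDissipativeLiouville
    (hRDL : Theses.LerayQuarterDissipation.RecurrentDissipativeLiouville) (c : ℝ) :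
    TypeIDSSLiouville c := by
  intro hc u hu hmeas hdss hdec
  obtain ⟨C₀, hC₀⟩ := hdec
  obtain ⟨V, hV, hdssV', hdecV, hVu, -⟩ :=
    rdssClass_smoothRepresentative_ae (R := LinearIsometryEquiv.refl ℝ (EuclideanSpace ℝ (Fin 3)))
      hc hu hmeas (isRotatedDSS_refl_iff.2 hdss) hC₀
  have hdssV : IsDiscretelySelfSimilar c V := isRotatedDSS_refl_iff.1 hdssV'
  obtain ⟨K', hD⟩ := exists_dissipationLaw_of_hasTypeIDecay hV hdecV
  have hns := hRDL C₀ K' V hV hD (scalingRecurrence_of_isDiscretelySelfSimilar hc hdssV)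
  have hz : ∀ t < 0, ∀ x, V t x = 0 :=
    FiniteDissipationLiouville.Negative.eq_zero_of_dss_of_not_singularAtApex hc hdssV hns
  intro t ht
  filter_upwards [hVu t ht] with x hx
  rw [Pi.zero_apply, ← hx, hz t ht x]

/-- Contrapositive, for the disprover: a failure of `TypeIDSSLiouville λ` for one `λ` refutes the
child crux `RecurrentDissipativeLiouville`. -/
theorem not_recurrentDissipativeLiouville_of_not_typeIDSSLiouville {c : ℝ}
    (h : ¬ TypeIDSSLiouville c) : ¬ Theses.LerayQuarterDissipation.RecurrentDissipativeLiouville :=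
  fun hRDL => h (typeIDSSLiouville_of_recurrentDissipativeLiouville hRDL c)

/-- **Kill criterion for the child crux**: any PLAIN Type-I DSS profile (`IsTypeIDSSProfile c 1 u`)
refutes `RecurrentDissipativeLiouville`. -/
theorem not_recurrentDissipativeLiouville_of_isTypeIDSSProfile_refl {c : ℝ}
    {u : ℝ → EuclideanSpace ℝ (Fin 3) → EuclideanSpace ℝ (Fin 3)}
    (h : IsTypeIDSSProfile c (LinearIsometryEquiv.refl ℝ (EuclideanSpace ℝ (Fin 3))) u) :
    ¬ Theses.LerayQuarterDissipation.RecurrentDissipativeLiouville :=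
  fun hRDL => h.not_rotatedTypeIDSSLiouville ((rotatedTypeIDSSLiouville_refl_iff c).2
    (typeIDSSLiouville_of_recurrentDissipativeLiouville hRDL c))

end Summit.NavierStokesRegularity.NavierStokesRegularity.Theorems.FiniteDissipationLiouville.Hardness

end
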